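import Literature.AlgebraicGeometry.ModuliOfAbelianVarieties.SiegelHeckeQuotientAdmissible
import Literature.AlgebraicGeometry.ModuliOfAbelianVarieties.SiegelAdmissibleOfIsoTriple
import Literature.AlgebraicGeometry.ModuliOfAbelianVarieties.SiegelFineModuliDeformationBridge
import Literature.AlgebraicGeometry.AbelianSchemes.PolarizedAbelianSchemeWithLevelBaseChange
import HarnessLib

/-!
# Period compatibility of a POINTWISE Hecke quotient over a piece of the Siegel modular variety
# ([Milne 2005] §5 Def. 5.14, §6 Thm. 6.11; [Deligne 1971] 4.11–4.12; [MFK94] Ch. 7 §3)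

Topic `AlgebraicGeometry/ModuliOfAbelianVarieties`; namespace `Literature.AlgebraicGeometry.ModuliOfAbelianVarieties`.
KERNEL ONLY: theorems; no definition, no named fact, no instance, no `sorry`.

Cell hodgecm-mathlib, Hecke-link line, socket (B) «isogeny-quotient map», the ASSEMBLY above the pointwise theorem ★
`isAdmissibleAt_heckeQuotient` (p743730): the PERIOD-COMPATIBILITY CLAUSE the infinitesimal transfer (T2) consumes.  Data: a
piece `ι′ : S″ ⟶ 𝓜′_ℂ` of the level-`N′` variety (`N′ = N·d`), a map `Φ : S″(ℂ) → 𝓜_ℂ(ℂ)` (the candidate quotient map on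
complex points), the link data `(θ, γ, r, r′, ν)` with ★ `QuotientAdapted`, and AT EVERY complex point `s` of `S″` a
«pointwise Hecke quotient»: a level-`N` triple `Q_s` over `Spec ℂ` of class `Φ(s)` with a dominant homomorphism
`ψ_s : 𝒰′_{ι′s} → Q_s` from the identity fibre of the UNIVERSAL level-`N′` triple at `ι′ s` (★ `univ.baseChange`) satisfying the
algebraic clauses (K)(S)(L)(W‴) of ★ `isAdmissibleAt_heckeQuotient`.  CONCLUSION `hcompat`: every `(Z, r′)`-admissible level-`N′`
triple `P′` of class `ι′ s` has the `(θZ, r)`-admissible partner `Q_s` of class `Φ s` — because `P′ ≅ 𝒰′_{ι′s}` (★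
`classifyingMap_eq_iff_exists_isBaseChangeVia_id`), admissibility transports along isomorphisms of triples (★
`isAdmissibleAt_of_isBaseChangeVia_id'`), and ★ `isAdmissibleAt_heckeQuotient` applies to `ψ_s`.

* `hcompat_of_pointwiseHeckeQuotient` — the statement above (the algebraic quotient TRIPLE over `S″`, when it lands, supplies
  `Φ := q(ℂ)` and the pointwise data by base change to its complex points).

## References
* [Milne2005ShimuraVarieties] §5 p. 58 (Def. 5.14), §6 Thm. 6.11 pp. 74–75.
* [Deligne1971TravauxShimura] 4.11–4.12 pp. 148–149.
* [MumfordFogartyKirwan1994] Ch. 7 §2 Def. 7.2 (p. 129), §3 (p. 139).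
HC_CM is proved only modulo the 7 printed citations until rung 0 closes; this file discharges none of them.
-/

set_option autoImplicit false

noncomputable section

open CategoryTheory AlgebraicGeometry Matrix
open Literature.AlgebraicGeometry.Motives (AbelianVariety AlgPoints CartierDivisor specOver ComplexPoints)
open Literature.AlgebraicGeometry.AbelianSchemes (AbelianSchemeOver PolarizedAbelianSchemeWithLevel)
open Literature.NumberTheory.Adeles
open Literature.NumberTheory.Automorphic (siegelUpperHalfSpace)

namespace Literature.AlgebraicGeometry.ModuliOfAbelianVarieties

open SiegelModuli
open scoped MonObj

/-- **PERIOD COMPATIBILITY OF A POINTWISE HECKE QUOTIENT** (module docstring): under the link data and a pointwise Hecke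
quotient `(Q_s, ψ_s)` of class `Φ s` at every complex point `s` of the piece, every `(Z, r′)`-admissible level-`N′` triple of
class `ι′ s` has the `(θ Z, r)`-admissible partner `Q_s` of class `Φ s`.
[cite: Milne2005ShimuraVarieties, §5 p. 58 (Def. 5.14) and §6 Thm. 6.11 p. 74 and p. 75]
[cite: MumfordFogartyKirwan1994, Ch. 7 §2 Definition 7.2 (p. 129)] -/
theorem hcompat_of_pointwiseHeckeQuotient {g N N' d : ℕ} {δ : Fin g → ℕ} (hδ : IsPolarizationType δ) (hg : 0 < g)
    (hN : 1 < N) (hd : N' = N * d) (hd0 : d ≠ 0)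
    (𝓜 : SiegelFineModuliScheme g N δ) (𝓜' : SiegelFineModuliScheme g N' δ) [IsLocallyNoetherian (specOver ℚ ℂ).left]
    {S'' : Motives.SchemeOver ℂ} (ι' : S'' ⟶ (Motives.baseChange ℚ ℂ).obj 𝓜'.M)
    (Φ : ComplexPoints S'' → ComplexPoints ((Motives.baseChange ℚ ℂ).obj 𝓜.M))
    (r r' : gspFinAdelic δ) (hr : r ∈ principalLevelSubgroup δ 1) (γq : GL (Fin g ⊕ Fin g) ℚ) (ν : ℕ)
    (θ : siegelUpperHalfSpace g → siegelUpperHalfSpace g)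
    (hθ : ∀ Z : siegelUpperHalfSpace g, jOfSiegel δ ((θ Z : siegelUpperHalfSpace g) : Matrix (Fin g) (Fin g) ℂ) =
      conjJ (Matrix.GeneralLinearGroup.map (algebraMap ℚ ℝ) γq) (jOfSiegel δ (Z : Matrix (Fin g) (Fin g) ℂ)))
    (hQA : QuotientAdapted δ δ N N' r r' γq)
    (hQA3 : (γq : Matrix (Fin g ⊕ Fin g) (Fin g ⊕ Fin g) ℚ)ᵀ * typeFormOver δ ℚ *
      (γq : Matrix (Fin g ⊕ Fin g) (Fin g ⊕ Fin g) ℚ) = (ν : ℚ) • typeFormOver δ ℚ)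
    (hquot : ∀ s : ComplexPoints S'',
      let U : PolarizedAbelianSchemeWithLevel g N' δ (specOver ℚ ℂ).left :=
        𝓜'.univ.baseChange ((AlgPoints.baseChangeEquiv (algebraMap ℚ ℂ) 𝓜'.M).symm (AlgPoints.map (L := ℂ) ι' s)).left
      ∃ (Q : PolarizedAbelianSchemeWithLevel g N δ (specOver ℚ ℂ).left)
        (ψ : (U.A.fibre (𝟙 (Spec (CommRingCat.of ℂ)))).toAbelianVariety ⟶
          (Q.A.fibre (𝟙 (Spec (CommRingCat.of ℂ)))).toAbelianVariety)
        (_ : IsDominant ψ.hom.hom.hom.left),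
        (Q.A.fibre (𝟙 (Spec (CommRingCat.of ℂ)))).toAbelianVariety.dim = g ∧
        (∀ (Z : Matrix (Fin g) (Fin g) ℂ) (hZ : Z ∈ siegelUpperHalfSpace g)
          (m : SiegelAdelicMarking ⟨jOfSiegel δ Z, SiegelComplexRecordSystem.jOfSiegel_mem_C0pm hδ.1 hZ⟩ r'
            (U.A.fibre (𝟙 (Spec (CommRingCat.of ℂ)))).toAbelianVariety) (v : Fin g ⊕ Fin g → ℚ),
          AlgPoints.map ψ.hom.hom.hom (m.r v) = 1 ↔
            (γq : Matrix (Fin g ⊕ Fin g) (Fin g ⊕ Fin g) ℚ) *ᵥ v ∈ latticeOfGL (r : GL (Fin g ⊕ Fin g) finAdeleQ)) ∧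
        Function.Surjective (AlgPoints.map (L := ℂ) ψ.hom.hom.hom :
          (U.A.fibre (𝟙 (Spec (CommRingCat.of ℂ)))).toAbelianVariety.Points ℂ →
            (Q.A.fibre (𝟙 (Spec (CommRingCat.of ℂ)))).toAbelianVariety.Points ℂ) ∧
        (∀ i : Fin g ⊕ Fin g,
          Q.A.restrictPt (𝟙 (Spec (CommRingCat.of ℂ))) (Q.level.σ i) =
            AlgPoints.map ψ.hom.hom.hom (U.A.restrictPt (𝟙 (Spec (CommRingCat.of ℂ))) (U.level.σ i ^ d))) ∧
        (∀ (Θ' : CartierDivisor (U.A.fibre (𝟙 (Spec (CommRingCat.of ℂ)))).toAbelianVariety.X.left)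
          (Θ : CartierDivisor (Q.A.fibre (𝟙 (Spec (CommRingCat.of ℂ)))).toAbelianVariety.X.left),
          U.A.IsLambdaOfAt (𝟙 (Spec (CommRingCat.of ℂ))) U.D U.pol.lam Θ' →
          Q.A.IsLambdaOfAt (𝟙 (Spec (CommRingCat.of ℂ))) Q.D Q.pol.lam Θ →
          ∀ x : (U.A.fibre (𝟙 (Spec (CommRingCat.of ℂ)))).toAbelianVariety.Points ℂ,
            (((Θ.pullback ψ.hom.hom.hom.left + -(ν • Θ')).pullback
              ((U.A.fibre (𝟙 (Spec (CommRingCat.of ℂ)))).toAbelianVariety.translation x).left).LinEquiv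
              (Θ.pullback ψ.hom.hom.hom.left + -(ν • Θ')))) ∧
        AlgPoints.baseChangeEquiv (algebraMap ℚ ℂ) 𝓜.M (𝓜.classifyingMap (specOver ℚ ℂ) Q) = Φ s) :
    ∀ (s : ComplexPoints S'') (Z : siegelUpperHalfSpace g)
      (P' : PolarizedAbelianSchemeWithLevel g N' δ (specOver ℚ ℂ).left),
      IsAdmissibleAt hδ r' Z.1 Z.2 P' →
      AlgPoints.baseChangeEquiv (algebraMap ℚ ℂ) 𝓜'.M (𝓜'.classifyingMap (specOver ℚ ℂ) P') = AlgPoints.map (L := ℂ) ι' s →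
      ∃ P : PolarizedAbelianSchemeWithLevel g N δ (specOver ℚ ℂ).left,
        IsAdmissibleAt hδ r (θ Z).1 (θ Z).2 P ∧
        AlgPoints.baseChangeEquiv (algebraMap ℚ ℂ) 𝓜.M (𝓜.classifyingMap (specOver ℚ ℂ) P) = Φ s := by
  intro s Z P' hadm hcls
  -- the universal triple at the ℚ-morphism form `y` of the complex point `ι′ s`
  set y := (AlgPoints.baseChangeEquiv (algebraMap ℚ ℂ) 𝓜'.M).symm (AlgPoints.map (L := ℂ) ι' s) with hy
  set U : PolarizedAbelianSchemeWithLevel g N' δ (specOver ℚ ℂ).left := 𝓜'.univ.baseChange y.left with hU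
  have hyU : y = 𝓜'.classifyingMap (specOver ℚ ℂ) U :=
    𝓜'.eq_classifyingMap (specOver ℚ ℂ) U y ⟨_, _, 𝓜'.univ.baseChange_isBaseChangeVia y.left⟩
  -- `P′` and `U` have the same class, hence are isomorphic triples; transport admissibility to `U`
  have hclsU : 𝓜'.classifyingMap (specOver ℚ ℂ) U = 𝓜'.classifyingMap (specOver ℚ ℂ) P' := by
    rw [← hyU, hy]
    apply (AlgPoints.baseChangeEquiv (algebraMap ℚ ℂ) 𝓜'.M).injective
    rw [Equiv.apply_symm_apply, hcls]
    rfl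
  obtain ⟨G, Ĝ, hBC⟩ := (𝓜'.classifyingMap_eq_iff_exists_isBaseChangeVia_id U P').1 hclsU
  have hadmU : IsAdmissibleAt hδ r' Z.1 Z.2 U := isAdmissibleAt_of_isBaseChangeVia_id' hδ hBC hadm
  -- the pointwise Hecke quotient at `s`
  obtain ⟨Q, ψ, hψ, hdim, hker, hsurj, hlev, hW, hclsQ⟩ := hquot s
  haveI := hψ
  refine ⟨Q, ?_, hclsQ⟩
  exact isAdmissibleAt_heckeQuotient hδ hg hN hd hd0 Z.1 Z.2 (θ Z).1 (θ Z).2 r r' hr γq ν (hθ Z) hQA hQA3 U Q ψ hdim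
    (hker Z.1 Z.2) hsurj hlev hW hadmU

end Literature.AlgebraicGeometry.ModuliOfAbelianVarieties

end
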